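import Mathlib.MeasureTheory.Integral.IntervalIntegral.FundThmCalculus
import Mathlib.Analysis.Calculus.Deriv.Basic
import HarnessLib

/-!
# The Freidlin–Wentzell action functional and quasipotential of a drift field

Probability/Process definition file (sorry-free, no named facts).

For the dynamical system `ẋ = b(x)` on `ℝʳ` perturbed by a small white noise,
`dXᵋ = b(Xᵋ) dt + √ε dW`, the (normalised) **action functional** of a path `φ` on `[0, T]` is
`S_{0T}(φ) = ½ ∫₀ᵀ |φ̇ₛ − b(φₛ)|² ds` for absolutely continuous `φ` (and `+∞` otherwise)
(Freidlin 1985, §1.7, Thm. 7.4 with `(aⁱʲ)` the unit matrix; Freidlin–Wentzell, Ch. 4), and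
the **quasipotential** of `b` is
`V(x, y) = inf { S_{T₁T₂}(φ) : φ_{T₁} = x, φ_{T₂} = y, T₁ < T₂ }`
(Freidlin 1985, §4.1 and §4.4, formula before (4.28), with `x = O` an equilibrium;
Freidlin–Wentzell, Ch. 4 §2 for `V(O, x)` and Ch. 6 for `V(x, y)`; the same control-theoretic
object — "the minimal energy `½ ∫ |u|²` of a control `u` steering `ḟ = b(f) + u` from `x` to
`y`" — is the quasi-potential `I(x, y)` of Da Prato–Zabczyk, §12.5.3, (12.40)).
No probability is needed to *state* these objects: they are deterministic optimal-control
functionals of the drift `b` alone.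

This file vendors them for a drift `b : E → E` on a real normed space `E` (the consuming
routes take `E` finite-dimensional Euclidean), between **sets** `A, B ⊆ E`:

* `fwAction b T φ = ½ ∫₀ᵀ ‖φ̇⁺(t) − b(φ t)‖² dt : ℝ`, where `φ̇⁺(t) = derivWithin φ (Ioi t) t`
  is the right derivative;
* `IsFWPath b T φ` — the competitor class: `0 < T`, `φ` continuous on `[0, T]`,
  right-differentiable at every `t ∈ [0, T)`, with `‖φ̇⁺ − b ∘ φ‖²` integrable on `[0, T]`;
* `fwActionSet b A B` — the set of actions of competitors with `φ 0 ∈ A`, `φ T ∈ B`;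
* `fwQuasipotential b A B = sInf (fwActionSet b A B) : ℝ` — the quasipotential `V_b(A, B)`;
  `V_b({x}, {y})` is Freidlin–Wentzell's `V(x, y)`.

## Design choices

* **Competitor class.** Freidlin–Wentzell minimise over absolutely continuous paths. We take
  continuous paths with a *right* derivative at every point of `[0, T)` and integrable
  integrand: this class contains every `C¹` and every piecewise-`C¹` path, is closed under
  concatenation (`IsFWPath.append` in `FWQuasipotentialPaths` — so the triangle inequality is
  elementary, no smoothing at the junction), and Mathlib's FTC for right derivatives
  (`intervalIntegral.integral_eq_sub_of_hasDeriv_right_of_le` and its one-sided versions) applies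
  to it verbatim, which is all the completed-square arguments of the theory use
  (see `FWQuasipotentialGradient`). For continuous `b` every competitor is absolutely
  continuous (its right derivative is integrable), and `C¹` paths are dense in energy, so the
  infimum is Freidlin–Wentzell's; we do not formalize that remark.
* **Real values, `sInf`.** All actions are `≥ 0`, so the infimum is a genuine real infimum
  whenever some competitor exists (`fwActionSet_nonempty` in `FWQuasipotentialPaths`: `A`, `B`
  nonempty and `b` continuous suffice — a straight segment is a competitor). JUNK VALUE: if no
  competitor exists (e.g. `A = ∅` or `B = ∅`) then `fwQuasipotential b A B = sInf ∅ = 0`; the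
  order lemmas (`fwQuasipotential_anti`, `fwQuasipotential_triangle`, lower bounds) therefore
  carry the relevant nonemptiness hypotheses.
* `V(x, x) = 0` is an infimum, not a minimum (constant paths of duration `T → 0`), exactly as in
  the sources (`T > 0` is part of the competitor class).

## API (all proved)

`fwAction_nonneg`, `fwAction_eq_of_hasDerivWithinAt` (compute the action from any right
derivative), `IsFWPath.of_hasDerivAt` (`C¹` competitors), `IsFWPath.of_flow`,
`isFWPath_const` / `fwAction_const`, the `sInf` interface (`fwQuasipotential_le`,
`le_fwQuasipotential`, `exists_fwAction_lt`), `fwQuasipotential_nonneg`,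
`fwQuasipotential_eq_zero_of_inter_nonempty` (`V(A, B) = 0` if `A ∩ B ≠ ∅`),
`fwQuasipotential_eq_zero_of_flow` (`V = 0` along a trajectory of `ẋ = b(x)`) and
`fwQuasipotential_anti` (antitone in both sets). Straight segments, the existence of competitors
for continuous `b`, concatenation and the triangle inequality `V(A, C) ≤ V(A, {x}) + V({x}, C)`
are in `Literature/Probability/Process/FWQuasipotentialPaths.lean`; the completed-square
certificate and the gradient case (Freidlin–Wentzell, Ch. 4, Thm. 3.1) in
`Literature/Probability/Process/FWQuasipotentialGradient.lean`.

## Mathlib / tree search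

Mathlib (this pin) has no action functional / quasipotential / minimum-energy notion (searched
`quasipotential`, `actionFunctional`, `minimumEnergy`, `rateFunction`); the tree has only the
infinite-dimensional Navier–Stokes control form `Literature.Analysis.FluidPDE.nsQuasipotential`
(`ℝ≥0∞`-valued, from rest, finite horizon), which this file does not depend on or duplicate.

## References

* M. I. Freidlin, *Functional Integration and Partial Differential Equations*, Annals of Math.
  Studies 109 (1985), §1.7 Thm. 7.4 (action functional), §4.1 and §4.4 (quasi-potential).
  [Freidlin1985]
* M. I. Freidlin, A. D. Wentzell, *Random Perturbations of Dynamical Systems*, 3rd ed.,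
  Grundlehren 260 (2012), Ch. 4 §§2–3 (quasipotential w.r.t. an equilibrium, Thm. 3.1),
  Ch. 6 (`V(x, y)`). [FreidlinWentzell2012]
* G. Da Prato, J. Zabczyk, *Stochastic Equations in Infinite Dimensions*, 2nd ed. (2014),
  §12.5.3, (12.40) (quasi-potential `I(x, y)` in control form), Thm. 12.25. [DapratoZabczyk2014]
-/

noncomputable section

open MeasureTheory Set Filter intervalIntegral
open scoped Topology

namespace Literature.Probability.Process

variable {E : Type*}

/-! ### Two measure-zero bookkeeping lemmas -/

/-- Interval integrals over `[a, c]`, `a ≤ c`, of two functions agreeing on the open interval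
`(a, c)` coincide (endpoints are Lebesgue-null). [folklore] -/
theorem intervalIntegral_congr_Ioo {f g : ℝ → ℝ} {a c : ℝ} (hac : a ≤ c)
    (h : EqOn f g (Ioo a c)) : ∫ t in a..c, f t = ∫ t in a..c, g t := by
  rw [integral_of_le hac, integral_of_le hac, integral_Ioc_eq_integral_Ioo,
    integral_Ioc_eq_integral_Ioo]
  exact setIntegral_congr_fun measurableSet_Ioo h

/-- Interval integrability on `[a, c]`, `a ≤ c`, only depends on the values on `(a, c)`.
[folklore] -/
theorem intervalIntegrable_congr_Ioo {f g : ℝ → ℝ} {a c : ℝ} (hac : a ≤ c)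
    (h : EqOn f g (Ioo a c)) (hf : IntervalIntegrable f volume a c) :
    IntervalIntegrable g volume a c := by
  rw [intervalIntegrable_iff_integrableOn_Ioo_of_le hac] at hf ⊢
  exact hf.congr_fun h measurableSet_Ioo

/-! ### The action functional -/

section Action

variable [NormedAddCommGroup E] [NormedSpace ℝ E] {b : E → E} {T : ℝ} {φ φ' : ℝ → E}

/-- **The Freidlin–Wentzell action functional** `S_{0T}(φ) = ½ ∫₀ᵀ ‖φ̇⁺(t) − b(φ(t))‖² dt` of a
path `φ : ℝ → E` on `[0, T]` relative to the drift `b`, where `φ̇⁺(t) = derivWithin φ (Ioi t) t`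
is the right derivative (for a `C¹` path this is `φ̇`, `fwAction_eq_of_hasDerivWithinAt`). A
real number (Bochner/interval integral; meaningful on the competitor class `IsFWPath`, where the
integrand is integrable). This is `S_{0T}` of Freidlin 1985, §1.7, Thm. 7.4, for the identity
diffusion matrix. [cite: Freidlin1985, §1.7 Thm. 7.4] -/
def fwAction (b : E → E) (T : ℝ) (φ : ℝ → E) : ℝ :=
  (1 / 2) * ∫ t in (0 : ℝ)..T, ‖derivWithin φ (Ioi t) t - b (φ t)‖ ^ 2

/-- Unfolding the action functional. [cite: Freidlin1985, §1.7 Thm. 7.4] -/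
theorem fwAction_def (b : E → E) (T : ℝ) (φ : ℝ → E) :
    fwAction b T φ = (1 / 2) * ∫ t in (0 : ℝ)..T, ‖derivWithin φ (Ioi t) t - b (φ t)‖ ^ 2 :=
  rfl

/-- The action is non-negative (for `0 ≤ T`). [folklore] -/
theorem fwAction_nonneg (b : E → E) (hT : 0 ≤ T) (φ : ℝ → E) : 0 ≤ fwAction b T φ :=
  mul_nonneg (by norm_num) (intervalIntegral.integral_nonneg hT fun _ _ => sq_nonneg _)

/-- **Computing the action from a right derivative**: if `φ` has right derivative `φ' t` at
every `t ∈ (0, T)` then `S_{0T}(φ) = ½ ∫₀ᵀ ‖φ' t − b(φ t)‖² dt`. [folklore] -/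
theorem fwAction_eq_of_hasDerivWithinAt (hT : 0 ≤ T)
    (h : ∀ t ∈ Ioo 0 T, HasDerivWithinAt φ (φ' t) (Ioi t) t) :
    fwAction b T φ = (1 / 2) * ∫ t in (0 : ℝ)..T, ‖φ' t - b (φ t)‖ ^ 2 := by
  unfold fwAction
  congr 1
  refine intervalIntegral_congr_Ioo hT fun t ht => ?_
  rw [(h t ht).derivWithin (uniqueDiffWithinAt_Ioi t)]

/-- A path following the flow `φ̇ = b(φ)` on `(0, T)` has zero action. [folklore] -/
theorem fwAction_eq_zero_of_flow (hT : 0 ≤ T)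
    (h : ∀ t ∈ Ioo 0 T, HasDerivWithinAt φ (b (φ t)) (Ioi t) t) : fwAction b T φ = 0 := by
  rw [fwAction_eq_of_hasDerivWithinAt hT h]
  simp

end Action

/-! ### The competitor class -/

section Path

variable [NormedAddCommGroup E] [NormedSpace ℝ E] {b : E → E} {T : ℝ} {φ φ' : ℝ → E}

/-- **Admissible path** for the Freidlin–Wentzell variational problems on `[0, T]`: positive
duration, `φ` continuous on `[0, T]`, right-differentiable at every `t ∈ [0, T)`, and the action
integrand `‖φ̇⁺ − b ∘ φ‖²` integrable on `[0, T]` (so that `fwAction b T φ` is its honest value).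
Contains all `C¹` paths (`IsFWPath.of_hasDerivAt`) and is closed under concatenation
(`IsFWPath.append` in `FWQuasipotentialPaths`); for continuous `b` it consists of absolutely
continuous paths of finite action, the class of Freidlin 1985, §1.7, Thm. 7.4 /
Freidlin–Wentzell, Ch. 3–4 (see the module docstring for this design choice).
[cite: Freidlin1985, §1.7 Thm. 7.4] -/
structure IsFWPath (b : E → E) (T : ℝ) (φ : ℝ → E) : Prop where
  /-- The duration is positive. -/
  pos : 0 < T
  /-- The path is continuous on `[0, T]`. -/
  continuousOn : ContinuousOn φ (Icc 0 T)
  /-- The path is right-differentiable on `[0, T)`. -/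
  differentiableWithinAt : ∀ t ∈ Ico 0 T, DifferentiableWithinAt ℝ φ (Ioi t) t
  /-- The action integrand is integrable on `[0, T]`. -/
  intervalIntegrable :
    IntervalIntegrable (fun t => ‖derivWithin φ (Ioi t) t - b (φ t)‖ ^ 2) volume 0 T

/-- **`C¹` competitors**: a path differentiable at every point of `[0, T]`, `0 < T`, whose
velocity defect `φ' − b ∘ φ` is continuous on `[0, T]`, is admissible. [folklore] -/
theorem IsFWPath.of_hasDerivAt (hT : 0 < T) (hφ : ∀ t ∈ Icc 0 T, HasDerivAt φ (φ' t) t)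
    (hcont : ContinuousOn (fun t => φ' t - b (φ t)) (Icc 0 T)) : IsFWPath b T φ where
  pos := hT
  continuousOn t ht := (hφ t ht).continuousAt.continuousWithinAt
  differentiableWithinAt t ht :=
    (hφ t (Ico_subset_Icc_self ht)).differentiableAt.differentiableWithinAt
  intervalIntegrable := by
    have hI : IntegrableOn (fun t => ‖φ' t - b (φ t)‖ ^ 2) (Icc 0 T) :=
      (hcont.norm.pow 2).integrableOn_Icc
    refine intervalIntegrable_congr_Ioo hT.le (fun t ht => ?_)
      ((intervalIntegrable_iff_integrableOn_Icc_of_le hT.le).2 hI)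
    rw [((hφ t (Ioo_subset_Icc_self ht)).hasDerivWithinAt).derivWithin (uniqueDiffWithinAt_Ioi t)]

/-- **Flow lines are competitors**: a path continuous on `[0, T]` with right derivative
`b(φ t)` at every `t ∈ [0, T)` is admissible (its action integrand vanishes on `(0, T)`).
[folklore] -/
theorem IsFWPath.of_flow (hT : 0 < T) (hc : ContinuousOn φ (Icc 0 T))
    (h : ∀ t ∈ Ico 0 T, HasDerivWithinAt φ (b (φ t)) (Ioi t) t) : IsFWPath b T φ where
  pos := hT
  continuousOn := hc
  differentiableWithinAt t ht := (h t ht).differentiableWithinAt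
  intervalIntegrable := by
    refine intervalIntegrable_congr_Ioo hT.le (f := fun _ => 0) (fun t ht => ?_)
      intervalIntegrable_const
    simp only
    rw [(h t (Ioo_subset_Ico_self ht)).derivWithin (uniqueDiffWithinAt_Ioi t)]
    simp

/-! #### Constant paths -/

/-- The constant path at `x` is admissible for every duration `T > 0`. [folklore] -/
theorem isFWPath_const (b : E → E) (hT : 0 < T) (x : E) : IsFWPath b T fun _ => x where
  pos := hT
  continuousOn := continuousOn_const
  differentiableWithinAt _ _ := differentiableWithinAt_const _
  intervalIntegrable := by
    have : (fun t : ℝ => ‖derivWithin (fun _ : ℝ => x) (Ioi t) t - b x‖ ^ 2) =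
        fun _ => ‖b x‖ ^ 2 := by
      funext t
      simp [derivWithin_fun_const]
    rw [this]
    exact intervalIntegrable_const

/-- The constant path at `x` of duration `T` has action `½ T ‖b x‖²`. [folklore] -/
theorem fwAction_const (b : E → E) (T : ℝ) (x : E) :
    fwAction b T (fun _ => x) = T / 2 * ‖b x‖ ^ 2 := by
  have : (fun t : ℝ => ‖derivWithin (fun _ : ℝ => x) (Ioi t) t - b x‖ ^ 2) =
      fun _ => ‖b x‖ ^ 2 := by
    funext t
    simp [derivWithin_fun_const]
  rw [fwAction, this, intervalIntegral.integral_const, sub_zero, smul_eq_mul]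
  ring

end Path

/-! ### The quasipotential -/

section Quasipotential

variable [NormedAddCommGroup E] [NormedSpace ℝ E] {b : E → E} {T : ℝ} {φ : ℝ → E}
  {A A' B B' : Set E} {a : ℝ}

/-- The set of actions `S_{0T}(φ)` of admissible paths (`IsFWPath b T φ`, any `T > 0`) leading
from `A` to `B`: `φ 0 ∈ A`, `φ T ∈ B`. [cite: Freidlin1985, §4.4 (definition of V)] -/
def fwActionSet (b : E → E) (A B : Set E) : Set ℝ :=
  {a | ∃ (T : ℝ) (φ : ℝ → E), IsFWPath b T φ ∧ φ 0 ∈ A ∧ φ T ∈ B ∧ fwAction b T φ = a}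

/-- **The Freidlin–Wentzell quasipotential** of the drift `b` between the sets `A` and `B`:
`V_b(A, B) = inf { S_{0T}(φ) : T > 0, φ admissible on [0, T], φ 0 ∈ A, φ T ∈ B }`, a real
number `≥ 0` (`fwQuasipotential_nonneg`). For points, `V_b({x}, {y})` is
`V(x, y) = inf { S_{T₁T₂}(φ) : φ_{T₁} = x, φ_{T₂} = y, T₁ < T₂ }` of Freidlin 1985, §4.4
(formula before (4.28); §4.1 with `x = O`), Freidlin–Wentzell, Ch. 4 §2 (`V(O, x)`) and Ch. 6
(`V(x, y)`), and the quasi-potential `I(x, y)` of Da Prato–Zabczyk (2014), (12.40). JUNK VALUE: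
`sInf ∅ = 0` when no admissible path joins `A` to `B` (e.g. `A = ∅`); see
`fwActionSet_nonempty_of_inter` and `fwActionSet_nonempty` (in `FWQuasipotentialPaths`).
[cite: Freidlin1985, §4.4 (definition of V)] -/
def fwQuasipotential (b : E → E) (A B : Set E) : ℝ :=
  sInf (fwActionSet b A B)

/-- Unfolding the quasipotential. [cite: Freidlin1985, §4.4 (definition of V)] -/
theorem fwQuasipotential_def (b : E → E) (A B : Set E) :
    fwQuasipotential b A B = sInf (fwActionSet b A B) :=
  rfl

/-- Admissible paths from `A` to `B` contribute their action. [folklore] -/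
theorem mem_fwActionSet (h : IsFWPath b T φ) (hA : φ 0 ∈ A) (hB : φ T ∈ B) :
    fwAction b T φ ∈ fwActionSet b A B :=
  ⟨T, φ, h, hA, hB, rfl⟩

/-- All actions are non-negative. [folklore] -/
theorem fwActionSet_nonneg : ∀ a ∈ fwActionSet b A B, 0 ≤ a := by
  rintro _ ⟨T, φ, h, -, -, rfl⟩
  exact fwAction_nonneg b h.pos.le φ

/-- The action set is bounded below (by `0`). [folklore] -/
theorem bddBelow_fwActionSet : BddBelow (fwActionSet b A B) :=
  ⟨0, fun _ ha => fwActionSet_nonneg _ ha⟩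

/-- The action set is monotone in both sets. [folklore] -/
theorem fwActionSet_mono (hA : A ⊆ A') (hB : B ⊆ B') :
    fwActionSet b A B ⊆ fwActionSet b A' B' := by
  rintro _ ⟨T, φ, hp, h0, hT, rfl⟩
  exact ⟨T, φ, hp, hA h0, hB hT, rfl⟩

/-- If `A` meets `B` there are competitors (constant paths). [folklore] -/
theorem fwActionSet_nonempty_of_inter (h : (A ∩ B).Nonempty) : (fwActionSet b A B).Nonempty :=
  let ⟨x, hA, hB⟩ := h
  ⟨_, mem_fwActionSet (isFWPath_const b one_pos x) hA hB⟩

/-- **`V ≥ 0`.** [cite: Freidlin1985, §4.1] -/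
theorem fwQuasipotential_nonneg : 0 ≤ fwQuasipotential b A B :=
  Real.sInf_nonneg fwActionSet_nonneg

/-- Every admissible path from `A` to `B` bounds the quasipotential by its action (`csInf_le`).
[cite: Freidlin1985, §4.4 (definition of V)] -/
theorem fwQuasipotential_le (h : IsFWPath b T φ) (hA : φ 0 ∈ A) (hB : φ T ∈ B) :
    fwQuasipotential b A B ≤ fwAction b T φ :=
  csInf_le bddBelow_fwActionSet (mem_fwActionSet h hA hB)

/-- Lower bounds: if some competitor exists, `a ≤ V_b(A, B)` as soon as `a` bounds the action of
every admissible path from `A` to `B` from below (`le_csInf`).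
[cite: Freidlin1985, §4.4 (definition of V)] -/
theorem le_fwQuasipotential (hne : (fwActionSet b A B).Nonempty)
    (h : ∀ (T : ℝ) (φ : ℝ → E), IsFWPath b T φ → φ 0 ∈ A → φ T ∈ B → a ≤ fwAction b T φ) :
    a ≤ fwQuasipotential b A B :=
  le_csInf hne (by
    rintro _ ⟨T, φ, hp, hA, hB, rfl⟩
    exact h T φ hp hA hB)

/-- Strict upper bounds are witnessed: if `V_b(A, B) < a` (and some competitor exists) then some
admissible path from `A` to `B` has action `< a`. [folklore] -/
theorem exists_fwAction_lt (hne : (fwActionSet b A B).Nonempty) (h : fwQuasipotential b A B < a) :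
    ∃ (T : ℝ) (φ : ℝ → E), IsFWPath b T φ ∧ φ 0 ∈ A ∧ φ T ∈ B ∧ fwAction b T φ < a := by
  obtain ⟨_, ⟨T, φ, hp, hA, hB, rfl⟩, hlt⟩ := exists_lt_of_csInf_lt hne h
  exact ⟨T, φ, hp, hA, hB, hlt⟩

/-- **`V` is antitone in both sets**: enlarging `A` or `B` admits more competitors (the smaller
problem must have a competitor, else its value is the junk `0`). [folklore] -/
theorem fwQuasipotential_anti (hne : (fwActionSet b A B).Nonempty) (hA : A ⊆ A') (hB : B ⊆ B') :
    fwQuasipotential b A' B' ≤ fwQuasipotential b A B :=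
  csInf_le_csInf bddBelow_fwActionSet hne (fwActionSet_mono hA hB)

/-- **`V(A, B) = 0` if `A ∩ B ≠ ∅`**: rest at a common point `x` for a short time `T`, at cost
`½ T ‖b x‖² → 0` (in particular `V(x, x) = 0`, Freidlin 1985, §4.1: `V(O) = 0`).
[cite: Freidlin1985, §4.1] -/
theorem fwQuasipotential_eq_zero_of_inter_nonempty (h : (A ∩ B).Nonempty) :
    fwQuasipotential b A B = 0 := by
  obtain ⟨x, hxA, hxB⟩ := h
  refine le_antisymm (le_of_forall_pos_le_add fun ε hε => ?_) fwQuasipotential_nonneg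
  set c := ‖b x‖ ^ 2 with hc_def
  have hc : 0 ≤ c := sq_nonneg _
  have hT : 0 < ε / (c + 1) := div_pos hε (by linarith)
  calc fwQuasipotential b A B ≤ fwAction b (ε / (c + 1)) (fun _ => x) :=
        fwQuasipotential_le (isFWPath_const b hT x) hxA hxB
    _ = ε / (c + 1) / 2 * c := fwAction_const b _ x
    _ ≤ 0 + ε := by
        have h1 : ε / (c + 1) * c ≤ ε := by
          rw [div_mul_eq_mul_div, div_le_iff₀ (by linarith)]
          nlinarith
        have h2 : ε / (c + 1) / 2 * c = ε / (c + 1) * c / 2 := by ring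
        rw [h2]
        linarith

/-- **`V = 0` along the flow**: if an admissible path following `φ̇ = b(φ)` on `(0, T)` leads
from `A` to `B`, then `V_b(A, B) = 0` (the unperturbed motion costs nothing).
[cite: Freidlin1985, §4.1] -/
theorem fwQuasipotential_eq_zero_of_flow (hφ : IsFWPath b T φ)
    (h : ∀ t ∈ Ioo 0 T, HasDerivWithinAt φ (b (φ t)) (Ioi t) t) (hA : φ 0 ∈ A) (hB : φ T ∈ B) :
    fwQuasipotential b A B = 0 :=
  le_antisymm ((fwQuasipotential_le hφ hA hB).trans_eq (fwAction_eq_zero_of_flow hφ.pos.le h))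
    fwQuasipotential_nonneg

end Quasipotential

end Literature.Probability.Process
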